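import Mathlib

/-!
# P6HubBarrierBezout — the Bezout identities of Lemma 1.3 of proofs/P6-K3HubBarrier-v1.1.md (D9 «K3-HUB-BARRIER»)

Kernel-checked identities in `ℤ[X]` for Mathlib's cyclotomic polynomials: `Φ₄ = X² + 1`, `Φ₆ = X² − X + 1`,
`Φ₈ = X⁴ + 1`, `Φ₁₂ = X⁴ − X² + 1`, and explicit cofactors showing that the ideals `(Φ₁₂, Φ_d)` (`d = 1, 2, 3, 4, 6`)
contain `1, 1, 2, 3, 2` and the ideals `(Φ₈, Φ_d)` (`d = 1, 2, 4`) contain `2`.  These replace the resultant citation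
in the proof of Theorem D9 (a): a finite abelian group annihilated by `Φ₁₂(h)` and by a product of `Φ_d(h)` is
annihilated by the corresponding product of these integers.  Supporting artefact only (README §2 / ROUTE R-5: finite
algebra, never the discharge of a Hodge-theoretic step).
-/

open Polynomial

namespace HodgeRepro0.P6HubBarrier

/-- `Φ₄ = X² + 1` (`Φ₄ = Φ₂(X²)`). -/
theorem cyclotomic_four_int : cyclotomic 4 ℤ = X ^ 2 + 1 := by
  have h := cyclotomic_expand_eq_cyclotomic (p := 2) (n := 2) Nat.prime_two (dvd_refl 2) ℤ
  rw [show (2 : ℕ) * 2 = 4 from rfl] at h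
  rw [← h, cyclotomic_two]
  simp [expand_X]

/-- `Φ₈ = X⁴ + 1` (`Φ₈ = Φ₄(X²)`). -/
theorem cyclotomic_eight_int : cyclotomic 8 ℤ = X ^ 4 + 1 := by
  have h := cyclotomic_expand_eq_cyclotomic (p := 2) (n := 4) Nat.prime_two (by norm_num) ℤ
  rw [show (4 : ℕ) * 2 = 8 from rfl] at h
  rw [← h, cyclotomic_four_int]
  simp [expand_X]
  ring

/-- `Φ₆ = X² − X + 1` (`Φ₃(X²) = Φ₆ · Φ₃`, cancel `Φ₃`). -/
theorem cyclotomic_six_int : cyclotomic 6 ℤ = X ^ 2 - X + 1 := by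
  have h := cyclotomic_expand_eq_cyclotomic_mul (p := 2) (n := 3) Nat.prime_two (by norm_num) ℤ
  rw [show (3 : ℕ) * 2 = 6 from rfl, cyclotomic_three] at h
  have h2 : expand ℤ 2 (X ^ 2 + X + 1 : ℤ[X]) = (X ^ 2 - X + 1) * (X ^ 2 + X + 1) := by
    simp [expand_X]
    ring
  have h3 : (X ^ 2 + X + 1 : ℤ[X]) ≠ 0 := by
    intro hc
    have := congrArg (fun q : ℤ[X] => q.eval 0) hc
    simp at this
  exact (mul_right_cancel₀ h3 (h2.symm.trans h)).symm

/-- `Φ₁₂ = X⁴ − X² + 1` (`Φ₁₂ = Φ₆(X²)`). -/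
theorem cyclotomic_twelve_int : cyclotomic 12 ℤ = X ^ 4 - X ^ 2 + 1 := by
  have h := cyclotomic_expand_eq_cyclotomic (p := 2) (n := 6) Nat.prime_two (by norm_num) ℤ
  rw [show (6 : ℕ) * 2 = 12 from rfl] at h
  rw [← h, cyclotomic_six_int]
  simp [expand_X]
  ring

/-- `Φ₁₂ − (X − 1)(X³ + X²) = 1`. -/
theorem bezout_12_1 : cyclotomic 12 ℤ - cyclotomic 1 ℤ * (X ^ 3 + X ^ 2) = 1 := by
  rw [cyclotomic_twelve_int, cyclotomic_one]; ring

/-- `Φ₁₂ − (X + 1)(X³ − X²) = 1`. -/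
theorem bezout_12_2 : cyclotomic 12 ℤ - cyclotomic 2 ℤ * (X ^ 3 - X ^ 2) = 1 := by
  rw [cyclotomic_twelve_int, cyclotomic_two]; ring

/-- `−X·Φ₁₂ + (X³ − X² − X + 2)·Φ₃ = 2`. -/
theorem bezout_12_3 : -X * cyclotomic 12 ℤ + (X ^ 3 - X ^ 2 - X + 2) * cyclotomic 3 ℤ = 2 := by
  rw [cyclotomic_twelve_int, cyclotomic_three]; ring

/-- `Φ₁₂ − (X² − 2)·Φ₄ = 3`. -/
theorem bezout_12_4 : cyclotomic 12 ℤ - (X ^ 2 - 2) * cyclotomic 4 ℤ = 3 := by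
  rw [cyclotomic_twelve_int, cyclotomic_four_int]; ring

/-- `X·Φ₁₂ + (−X³ − X² + X + 2)·Φ₆ = 2`. -/
theorem bezout_12_6 : X * cyclotomic 12 ℤ + (-X ^ 3 - X ^ 2 + X + 2) * cyclotomic 6 ℤ = 2 := by
  rw [cyclotomic_twelve_int, cyclotomic_six_int]; ring

/-- `Φ₈ − (X − 1)(X³ + X² + X + 1) = 2`. -/
theorem bezout_8_1 : cyclotomic 8 ℤ - cyclotomic 1 ℤ * (X ^ 3 + X ^ 2 + X + 1) = 2 := by
  rw [cyclotomic_eight_int, cyclotomic_one]; ring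

/-- `Φ₈ − (X + 1)(X³ − X² + X − 1) = 2`. -/
theorem bezout_8_2 : cyclotomic 8 ℤ - cyclotomic 2 ℤ * (X ^ 3 - X ^ 2 + X - 1) = 2 := by
  rw [cyclotomic_eight_int, cyclotomic_two]; ring

/-- `Φ₈ − (X² − 1)·Φ₄ = 2`. -/
theorem bezout_8_4 : cyclotomic 8 ℤ - (X ^ 2 - 1) * cyclotomic 4 ℤ = 2 := by
  rw [cyclotomic_eight_int, cyclotomic_four_int]; ring

/-- `2 ∈ (Φ₁₂, Φ₃)`. -/
theorem two_mem_span_12_3 : (2 : ℤ[X]) ∈ Ideal.span ({cyclotomic 12 ℤ, cyclotomic 3 ℤ} : Set ℤ[X]) := by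
  rw [← bezout_12_3]
  exact Ideal.add_mem _ (Ideal.mul_mem_left _ _ (Ideal.subset_span (by simp)))
    (Ideal.mul_mem_left _ _ (Ideal.subset_span (by simp)))

/-- `3 ∈ (Φ₁₂, Φ₄)`. -/
theorem three_mem_span_12_4 : (3 : ℤ[X]) ∈ Ideal.span ({cyclotomic 12 ℤ, cyclotomic 4 ℤ} : Set ℤ[X]) := by
  have h : (3 : ℤ[X]) = 1 * cyclotomic 12 ℤ + (-(X ^ 2 - 2)) * cyclotomic 4 ℤ := by
    rw [← bezout_12_4]; ring
  rw [h]
  exact Ideal.add_mem _ (Ideal.mul_mem_left _ _ (Ideal.subset_span (by simp)))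
    (Ideal.mul_mem_left _ _ (Ideal.subset_span (by simp)))

/-- `2 ∈ (Φ₁₂, Φ₆)`. -/
theorem two_mem_span_12_6 : (2 : ℤ[X]) ∈ Ideal.span ({cyclotomic 12 ℤ, cyclotomic 6 ℤ} : Set ℤ[X]) := by
  rw [← bezout_12_6]
  exact Ideal.add_mem _ (Ideal.mul_mem_left _ _ (Ideal.subset_span (by simp)))
    (Ideal.mul_mem_left _ _ (Ideal.subset_span (by simp)))

/-- `2 ∈ (Φ₈, Φ₄)`. -/
theorem two_mem_span_8_4 : (2 : ℤ[X]) ∈ Ideal.span ({cyclotomic 8 ℤ, cyclotomic 4 ℤ} : Set ℤ[X]) := by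
  have h : (2 : ℤ[X]) = 1 * cyclotomic 8 ℤ + (-(X ^ 2 - 1)) * cyclotomic 4 ℤ := by
    rw [← bezout_8_4]; ring
  rw [h]
  exact Ideal.add_mem _ (Ideal.mul_mem_left _ _ (Ideal.subset_span (by simp)))
    (Ideal.mul_mem_left _ _ (Ideal.subset_span (by simp)))

end HodgeRepro0.P6HubBarrier
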